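import Mathlib
import HarnessLib
import Summits.HubbardSuperconductivity.HubbardSuperconductivity.Theorems.AposterioriCapRgSeededBrokenRegimeBoseFermiPinnedPolchinskiBilinearBound
import Literature.MathematicalPhysics.QuantumLattice.GrassmannPresentedTensor

/-!
# Route `KLProgramme` — crux K3, VL child / engine two-leg export ((E3f)₀, stmt-HubbardSuperconductivity-19918): the FIXED-PIN, ONE-LEG-WEIGHTED
# kernel bound for the bilinear term of Polchinski's equation (cell gate-hubbard-kl, seat hubbard-kl-k3c5-p2 g5; mechanism β′ «semigroup defect»)

WHY.  In the nested two-volume pass (VL-TWO-VOLUME-MECHANISMS.md §4) the far half of the defect step is `effAction (s•D_far) W` along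
`s ∈ [0,1]`, differentiated by the tree's Polchinski equation (`GrassmannPolchinskiEquation.hasCoeffDerivAt_effAction_flow`):
`∂_s 𝒱_s = Δ_{D_far}𝒱_s − ½(δ𝒱_s/δψ, D_far δ𝒱_s/δψ) − const`.  The contraction term is bounded at a fixed pin by
`Literature…GrassmannWickLocalised` (one leg weighted).  This file bounds the BILINEAR term `Σ_{X,Y} C(X,Y) ∂_X F ∂_Y G` at a FIXED pin
value `w`, with the row and column sums of the line `C` allowed to carry a WEIGHT `ζ` on the contracted leg
(`Σ_Y ‖C X Y‖ ≤ cR·ζ X`, `Σ_X ‖C X Y‖ ≤ cC·ζ Y`): the weight lands on the contracted leg of exactly ONE of the two kernels, whose OTHER leg is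
pinned at `w` — so for a far-supported line (`ζ = 1_Z`, `Z` at distance `≥ R` from `w`) the cost is a first moment over `R`, while the
partner kernel pays only its plain leg-`0`-pinned norm.  (The route-side sup-over-pins, product-leg-weight estimate is c4's
`…AposterioriCapRgSeededBrokenRegimeBoseFermiPinned.PolchinskiBilinearBound.legKernelNorm_polchinskiBilinear_le`; its reindexing and
presentation lemmas are reused here by name.)

* `core_left_weighted` / `pinnedSum_contracted_le_weighted` — the real-valued tree-line estimate with `ζ`-weighted row/column sums;
* `sum_norm_kernel_presented_le_fixedPin` — antisymmetrisation at a fixed pin value costs nothing;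
* `pinnedSum_kernel_block_le_weighted` — the `(a,b)` block: `≤ (a+1)(b+1)·(cR·tF·nG + cC·nF·tG)`;
* **`sum_norm_kernel_bilinear_le_weighted`** — `Σ_{W : W_p = w} ‖kernel (Σ_{X,Y} C X Y • ∂_X F ∂_Y G) (n+1) W‖ ≤
  Σ_{a+b=n+1} (a+1)(b+1)·(cR·tF(a+1)·nG(b+1) + cC·nF(a+1)·tG(b+1))`, where `nF(m)` bounds the leg-`0`-pinned sums of `kernel F m` (any pin value)
  and `tF(m)` bounds the `ζ(leg 0)`-weighted sums of `kernel F m` pinned at value `w` on any OTHER leg.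

Everything is proved; no definition, no named fact; nothing is asserted about the model.
-/

noncomputable section

namespace Summit.HubbardSuperconductivity.HubbardSuperconductivity.Theorems.TwoVolumeDefect

set_option linter.dupNamespace false -- summit = problem name (single-conjunct summit), D-0017

open Finset Literature.MathematicalPhysics.QuantumLattice GrassmannAlgebra
open Summit.HubbardSuperconductivity.HubbardSuperconductivity.Theorems.AposterioriCapRgSeededBrokenRegimeBoseFermiPinned

variable {Γ : Type*} [Fintype Γ] [DecidableEq Γ]

/-! ## §1 The real-valued tree-line estimate with a weight on the contracted leg -/

/-- **Pin in the first block, weighted rows**: with `Σ_Y D X Y ≤ cR·ζ X`, the double sum pinned at leg `i.succ` of `A`'s block is at most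
`cR · tA · cB`, where `tA` bounds `A`'s `ζ(leg 0)`-weighted pinned sum at leg `i.succ` and `cB` bounds `B`'s leg-`0`-pinned sums.
[folklore; Salmhofer 1998 §4.1 Lemma 1 with a weight] -/
theorem core_left_weighted {a b : ℕ} (α : (Fin (a + 1) → Γ) → ℝ) (β : (Fin (b + 1) → Γ) → ℝ) (D : Γ → Γ → ℝ) (ζ : Γ → ℝ)
    (hα : ∀ U, 0 ≤ α U) (hβ : ∀ V, 0 ≤ β V) (hD : ∀ X Y, 0 ≤ D X Y)
    {tA cB cR : ℝ} (hcR : 0 ≤ cR) (i : Fin a) (w : Γ)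
    (hA : ∑ U ∈ univ.filter (fun U : Fin (a + 1) → Γ => U i.succ = w), ζ (U 0) * α U ≤ tA)
    (hB : ∀ Y, ∑ V ∈ univ.filter (fun V : Fin (b + 1) → Γ => V 0 = Y), β V ≤ cB)
    (hR : ∀ X, ∑ Y, D X Y ≤ cR * ζ X) :
    ∑ W₁ ∈ univ.filter (fun W₁ : Fin a → Γ => W₁ i = w), ∑ W₂ : Fin b → Γ,
        ∑ X, ∑ Y, D X Y * (α (Fin.cons X W₁) * β (Fin.cons Y W₂)) ≤ cR * (tA * cB) := by
  have hcB : 0 ≤ cB := (sum_nonneg fun V _ => hβ V).trans (hB w)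
  -- the free block: `B`'s pinned sum at leg `0`, then a weighted row sum of `D`
  have hin : ∀ X, ∑ Y, D X Y * ∑ W₂ : Fin b → Γ, β (Fin.cons Y W₂) ≤ cR * ζ X * cB := fun X =>
    calc ∑ Y, D X Y * ∑ W₂ : Fin b → Γ, β (Fin.cons Y W₂)
        ≤ ∑ Y, D X Y * cB := sum_le_sum fun Y _ =>
          mul_le_mul_of_nonneg_left ((ContractedTensor.sum_cons_eq_pinnedSum_zero β Y).trans_le (hB Y)) (hD X Y)
      _ ≤ cR * ζ X * cB := by
          rw [← sum_mul]
          exact mul_le_mul_of_nonneg_right (hR X) hcB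
  calc ∑ W₁ ∈ univ.filter (fun W₁ : Fin a → Γ => W₁ i = w), ∑ W₂ : Fin b → Γ,
          ∑ X, ∑ Y, D X Y * (α (Fin.cons X W₁) * β (Fin.cons Y W₂))
      = ∑ W₁ ∈ univ.filter (fun W₁ : Fin a → Γ => W₁ i = w),
          ∑ X, α (Fin.cons X W₁) * ∑ Y, D X Y * ∑ W₂ : Fin b → Γ, β (Fin.cons Y W₂) := by
        refine sum_congr rfl fun W₁ _ => ?_
        rw [sum_comm]
        refine sum_congr rfl fun X _ => ?_
        rw [sum_comm, mul_sum]
        refine sum_congr rfl fun Y _ => ?_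
        rw [mul_sum, mul_sum]
        exact sum_congr rfl fun W₂ _ => by ring
    _ ≤ ∑ W₁ ∈ univ.filter (fun W₁ : Fin a → Γ => W₁ i = w), ∑ X, α (Fin.cons X W₁) * (cR * ζ X * cB) :=
        sum_le_sum fun W₁ _ => sum_le_sum fun X _ => mul_le_mul_of_nonneg_left (hin X) (hα _)
    _ = (cR * cB) * ∑ X, ∑ W₁ ∈ univ.filter (fun W₁ : Fin a → Γ => W₁ i = w), ζ X * α (Fin.cons X W₁) := by
        rw [mul_sum, sum_comm]
        refine sum_congr rfl fun X _ => ?_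
        rw [mul_sum]
        exact sum_congr rfl fun W₁ _ => by ring
    _ = (cR * cB) * ∑ U ∈ univ.filter (fun U : Fin (a + 1) → Γ => U i.succ = w), ζ (U 0) * α U := by
        congr 1
        have h := ContractedTensor.sum_sum_cons_pinned_eq (fun U : Fin (a + 1) → Γ => ζ (U 0) * α U) i w
        simpa only [Fin.cons_zero] using h
    _ ≤ (cR * cB) * tA := mul_le_mul_of_nonneg_left hA (mul_nonneg hcR hcB)
    _ = cR * (tA * cB) := by ring

/-- **The weighted tree-line estimate**, both blocks: with `Σ_Y D X Y ≤ cR·ζ X` and `Σ_X D X Y ≤ cC·ζ Y`, every pinned sum (pin value `w`, any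
position) of `W ↦ Σ_{X,Y} D X Y · α(X ∷ W₁) · β(Y ∷ W₂)` is at most `cR·tA·nB + cC·nA·tB`, where `nA, nB` bound the leg-`0`-pinned sums (any value)
and `tA, tB` the `ζ(leg 0)`-weighted sums pinned at value `w` on the other legs. [folklore; Salmhofer 1998 §4.1 Lemma 1 with a weight] -/
theorem pinnedSum_contracted_le_weighted {a b : ℕ} (α : (Fin (a + 1) → Γ) → ℝ) (β : (Fin (b + 1) → Γ) → ℝ) (D : Γ → Γ → ℝ)
    (ζ : Γ → ℝ) (hα : ∀ U, 0 ≤ α U) (hβ : ∀ V, 0 ≤ β V) (hD : ∀ X Y, 0 ≤ D X Y)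
    {nA nB tA tB cR cC : ℝ} (hcR : 0 ≤ cR) (hcC : 0 ≤ cC) (htA : 0 ≤ tA) (htB : 0 ≤ tB) (w : Γ)
    (hA0 : ∀ x, ∑ U ∈ univ.filter (fun U : Fin (a + 1) → Γ => U 0 = x), α U ≤ nA)
    (hB0 : ∀ x, ∑ V ∈ univ.filter (fun V : Fin (b + 1) → Γ => V 0 = x), β V ≤ nB)
    (hAt : ∀ i : Fin a, ∑ U ∈ univ.filter (fun U : Fin (a + 1) → Γ => U i.succ = w), ζ (U 0) * α U ≤ tA)
    (hBt : ∀ j : Fin b, ∑ V ∈ univ.filter (fun V : Fin (b + 1) → Γ => V j.succ = w), ζ (V 0) * β V ≤ tB)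
    (hR : ∀ X, ∑ Y, D X Y ≤ cR * ζ X) (hC : ∀ Y, ∑ X, D X Y ≤ cC * ζ Y) (p : Fin (a + b)) :
    ∑ W ∈ univ.filter (fun W : Fin (a + b) → Γ => W p = w),
        ∑ X, ∑ Y, D X Y * (α (Fin.cons X fun i => W (Fin.castAdd b i)) * β (Fin.cons Y fun j => W (Fin.natAdd a j))) ≤
      cR * tA * nB + cC * nA * tB := by
  have hnA : 0 ≤ nA := (sum_nonneg fun U _ => hα U).trans (hA0 w)
  have hnB : 0 ≤ nB := (sum_nonneg fun V _ => hβ V).trans (hB0 w)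
  have h1 : 0 ≤ cR * tA * nB := by positivity
  have h2 : 0 ≤ cC * nA * tB := by positivity
  induction p using Fin.addCases with
  | left i =>
    refine (ContractedTensor.pinnedSum_castAdd_eq
      (fun W₁ W₂ => ∑ X, ∑ Y, D X Y * (α (Fin.cons X W₁) * β (Fin.cons Y W₂))) i w).trans_le ?_
    calc _ ≤ cR * (tA * nB) := core_left_weighted α β D ζ hα hβ hD hcR i w (hAt i) hB0 hR
      _ = cR * tA * nB := by ring
      _ ≤ cR * tA * nB + cC * nA * tB := le_add_of_nonneg_right h2
  | right j =>
    refine (ContractedTensor.pinnedSum_natAdd_eq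
      (fun W₁ W₂ => ∑ X, ∑ Y, D X Y * (α (Fin.cons X W₁) * β (Fin.cons Y W₂))) j w).trans_le ?_
    calc ∑ W₂ ∈ univ.filter (fun W₂ : Fin b → Γ => W₂ j = w), ∑ W₁ : Fin a → Γ,
            ∑ X, ∑ Y, D X Y * (α (Fin.cons X W₁) * β (Fin.cons Y W₂))
        = ∑ W₂ ∈ univ.filter (fun W₂ : Fin b → Γ => W₂ j = w), ∑ W₁ : Fin a → Γ,
            ∑ Y, ∑ X, D X Y * (β (Fin.cons Y W₂) * α (Fin.cons X W₁)) :=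
          sum_congr rfl fun W₂ _ => sum_congr rfl fun W₁ _ => by
            rw [sum_comm]
            exact sum_congr rfl fun Y _ => sum_congr rfl fun X _ => by ring
      _ ≤ cC * (tB * nA) :=
          core_left_weighted β α (fun Y X => D X Y) ζ hβ hα (fun Y X => hD X Y) hcC j w (hBt j) hA0 hC
      _ = cC * nA * tB := by ring
      _ ≤ cR * tA * nB + cC * nA * tB := le_add_of_nonneg_left h1

/-! ## §2 The `(a, b)` tensor block of the bilinear term at a fixed pin -/

section Block

variable {𝕜 : Type*} [RCLike 𝕜]

omit [DecidableEq Γ] in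
/-- Pointwise: `‖Σ_{X,Y} C X Y · ((a+1) kF(X∷W₁)) · ((b+1) kG(Y∷W₂))‖ ≤ Σ_{X,Y} ‖C X Y‖·((a+1)‖kF(X∷W₁)‖)·((b+1)‖kG(Y∷W₂)‖)`. [folklore] -/
theorem norm_contracted_le {a b : ℕ} (C : Matrix Γ Γ 𝕜) (kF : (Fin (a + 1) → Γ) → 𝕜) (kG : (Fin (b + 1) → Γ) → 𝕜)
    (W : Fin (a + b) → Γ) :
    ‖∑ X, ∑ Y, C X Y * ((((a + 1 : ℕ) : 𝕜) * kF (Fin.cons X fun i => W (Fin.castAdd b i))) *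
        (((b + 1 : ℕ) : 𝕜) * kG (Fin.cons Y fun j => W (Fin.natAdd a j))))‖ ≤
      ∑ X, ∑ Y, ‖C X Y‖ * ((((a + 1 : ℕ) : ℝ) * ‖kF (Fin.cons X fun i => W (Fin.castAdd b i))‖) *
        (((b + 1 : ℕ) : ℝ) * ‖kG (Fin.cons Y fun j => W (Fin.natAdd a j))‖)) := by
  refine (norm_sum_le _ _).trans (sum_le_sum fun X _ => (norm_sum_le _ _).trans (sum_le_sum fun Y _ => le_of_eq ?_))
  rw [norm_mul, norm_mul, norm_mul, norm_mul, RCLike.norm_natCast, RCLike.norm_natCast]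

/-- **The `(a, b)` block at a fixed pin**: the pinned sums (pin value `w`, any position) of the contracted tensor
`T_{ab}(W) = Σ_{X,Y} C X Y · (a+1) kernel F (a+1) (X∷W₁) · (b+1) kernel G (b+1) (Y∷W₂)` are at most
`(a+1)(b+1)·(cR·tF·nG + cC·nF·tG)` under `ζ`-weighted row/column sums of `C`, leg-`0`-pinned bounds `nF, nG` and `ζ(leg 0)`-weighted bounds
`tF, tG` at the pin value `w`. [folklore; Salmhofer 1998 §4.1 Lemma 1 with a weight] -/
theorem pinnedSum_tensorBlock_le_weighted {a b : ℕ} (C : Matrix Γ Γ 𝕜) (ζ : Γ → ℝ)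
    {cR cC : ℝ} (hcR : 0 ≤ cR) (hcC : 0 ≤ cC) (hR : ∀ X, ∑ Y, ‖C X Y‖ ≤ cR * ζ X) (hC : ∀ Y, ∑ X, ‖C X Y‖ ≤ cC * ζ Y)
    (F G : GrassmannAlgebra 𝕜 Γ) (w : Γ) {nF nG tF tG : ℝ} (htF : 0 ≤ tF) (htG : 0 ≤ tG)
    (hF0 : ∀ x, ∑ U ∈ univ.filter (fun U : Fin (a + 1) → Γ => U 0 = x), ‖kernel 𝕜 F (a + 1) U‖ ≤ nF)
    (hG0 : ∀ x, ∑ V ∈ univ.filter (fun V : Fin (b + 1) → Γ => V 0 = x), ‖kernel 𝕜 G (b + 1) V‖ ≤ nG)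
    (hFt : ∀ i : Fin a, ∑ U ∈ univ.filter (fun U : Fin (a + 1) → Γ => U i.succ = w), ζ (U 0) * ‖kernel 𝕜 F (a + 1) U‖ ≤ tF)
    (hGt : ∀ j : Fin b, ∑ V ∈ univ.filter (fun V : Fin (b + 1) → Γ => V j.succ = w), ζ (V 0) * ‖kernel 𝕜 G (b + 1) V‖ ≤ tG)
    (p : Fin (a + b)) :
    ∑ W ∈ univ.filter (fun W : Fin (a + b) → Γ => W p = w),
        ‖∑ X, ∑ Y, C X Y * ((((a + 1 : ℕ) : 𝕜) * kernel 𝕜 F (a + 1) (Fin.cons X fun i => W (Fin.castAdd b i))) *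
          (((b + 1 : ℕ) : 𝕜) * kernel 𝕜 G (b + 1) (Fin.cons Y fun j => W (Fin.natAdd a j))))‖ ≤
      (((a + 1) * (b + 1) : ℕ) : ℝ) * (cR * tF * nG + cC * nF * tG) := by
  have ha0 : (0 : ℝ) ≤ ((a + 1 : ℕ) : ℝ) := Nat.cast_nonneg _
  have hb0 : (0 : ℝ) ≤ ((b + 1 : ℕ) : ℝ) := Nat.cast_nonneg _
  -- the four bounds for the scaled kernel norms
  have hA0 : ∀ x, ∑ U ∈ univ.filter (fun U : Fin (a + 1) → Γ => U 0 = x), ((a + 1 : ℕ) : ℝ) * ‖kernel 𝕜 F (a + 1) U‖ ≤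
      ((a + 1 : ℕ) : ℝ) * nF := fun x => by
    rw [← mul_sum]; exact mul_le_mul_of_nonneg_left (hF0 x) ha0
  have hB0 : ∀ x, ∑ V ∈ univ.filter (fun V : Fin (b + 1) → Γ => V 0 = x), ((b + 1 : ℕ) : ℝ) * ‖kernel 𝕜 G (b + 1) V‖ ≤
      ((b + 1 : ℕ) : ℝ) * nG := fun x => by
    rw [← mul_sum]; exact mul_le_mul_of_nonneg_left (hG0 x) hb0
  have hAt : ∀ i : Fin a, ∑ U ∈ univ.filter (fun U : Fin (a + 1) → Γ => U i.succ = w),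
      ζ (U 0) * (((a + 1 : ℕ) : ℝ) * ‖kernel 𝕜 F (a + 1) U‖) ≤ ((a + 1 : ℕ) : ℝ) * tF := fun i => by
    have h : ∀ U : Fin (a + 1) → Γ, ζ (U 0) * (((a + 1 : ℕ) : ℝ) * ‖kernel 𝕜 F (a + 1) U‖) =
        ((a + 1 : ℕ) : ℝ) * (ζ (U 0) * ‖kernel 𝕜 F (a + 1) U‖) := fun U => by ring
    simp_rw [h]; rw [← mul_sum]; exact mul_le_mul_of_nonneg_left (hFt i) ha0
  have hBt : ∀ j : Fin b, ∑ V ∈ univ.filter (fun V : Fin (b + 1) → Γ => V j.succ = w),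
      ζ (V 0) * (((b + 1 : ℕ) : ℝ) * ‖kernel 𝕜 G (b + 1) V‖) ≤ ((b + 1 : ℕ) : ℝ) * tG := fun j => by
    have h : ∀ V : Fin (b + 1) → Γ, ζ (V 0) * (((b + 1 : ℕ) : ℝ) * ‖kernel 𝕜 G (b + 1) V‖) =
        ((b + 1 : ℕ) : ℝ) * (ζ (V 0) * ‖kernel 𝕜 G (b + 1) V‖) := fun V => by ring
    simp_rw [h]; rw [← mul_sum]; exact mul_le_mul_of_nonneg_left (hGt j) hb0
  have hcore := pinnedSum_contracted_le_weighted
    (fun U : Fin (a + 1) → Γ => ((a + 1 : ℕ) : ℝ) * ‖kernel 𝕜 F (a + 1) U‖)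
    (fun V : Fin (b + 1) → Γ => ((b + 1 : ℕ) : ℝ) * ‖kernel 𝕜 G (b + 1) V‖)
    (fun X Y => ‖C X Y‖) ζ (fun U => mul_nonneg ha0 (norm_nonneg _)) (fun V => mul_nonneg hb0 (norm_nonneg _))
    (fun X Y => norm_nonneg _) hcR hcC (mul_nonneg ha0 htF) (mul_nonneg hb0 htG) w hA0 hB0 hAt hBt hR hC p
  refine le_trans (sum_le_sum fun W _ => norm_contracted_le C _ _ W) (hcore.trans (le_of_eq ?_))
  push_cast
  ring

end Block

/-! ## §3 Antisymmetrisation and the degree blocks of the bilinear term -/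

section Assembly

variable {𝕜 : Type*} [RCLike 𝕜]

/-- Transport of a fixed-pin sum along an equality of degrees. [folklore] -/
theorem pinnedSum_congr_deg' {k k' : ℕ} (h : k = k') (φ : (Fin k → Γ) → 𝕜) (p : Fin k') (x : Γ) :
    ∑ W ∈ univ.filter (fun W : Fin k' → Γ => W p = x), ‖φ (fun i => W (Fin.cast h i))‖ =
      ∑ W ∈ univ.filter (fun W : Fin k → Γ => W (Fin.cast h.symm p) = x), ‖φ W‖ := by
  subst h; rfl

/-- **THE FIXED-PIN, ONE-LEG-WEIGHTED BOUND FOR THE BILINEAR TERM OF POLCHINSKI'S EQUATION.**  For a line `C` with `ζ`-weighted row and column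
sums (`Σ_Y ‖C X Y‖ ≤ cR·ζ X`, `Σ_X ‖C X Y‖ ≤ cC·ζ Y`), leg-`0`-pinned kernel bounds `nF, nG` (any pin value) and `ζ(leg 0)`-weighted kernel bounds
`tF, tG` at the pin value `w` (pinned on any other leg), for every degree `n + 1` and pin position `p`:
`Σ_{W : W_p = w} ‖kernel (Σ_{X,Y} C X Y • ∂_X F ∂_Y G) (n+1) W‖ ≤ Σ_{a+b=n+1} (a+1)(b+1)·(cR·tF(a+1)·nG(b+1) + cC·nF(a+1)·tG(b+1))`.
With `ζ = 1` this is the plain tree-line bound at a fixed pin; with `ζ = 1_Z` for a zone `Z` at distance `≥ R` from `w` (far-supported line)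
the `t`-bounds are first moments over `R`. [folklore; Salmhofer 1998 §4.1 Lemma 1 with a weight] -/
theorem sum_norm_kernel_bilinear_le_weighted (C : Matrix Γ Γ 𝕜) (ζ : Γ → ℝ)
    {cR cC : ℝ} (hcR : 0 ≤ cR) (hcC : 0 ≤ cC) (hR : ∀ X, ∑ Y, ‖C X Y‖ ≤ cR * ζ X) (hC : ∀ Y, ∑ X, ‖C X Y‖ ≤ cC * ζ Y)
    (F G : GrassmannAlgebra 𝕜 Γ) (w : Γ) (nF nG tF tG : ℕ → ℝ) (htF : ∀ m, 0 ≤ tF m) (htG : ∀ m, 0 ≤ tG m)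
    (hnF : ∀ m, 0 ≤ nF m) (hnG : ∀ m, 0 ≤ nG m)
    (hF0 : ∀ (m : ℕ) (x : Γ), ∑ U ∈ univ.filter (fun U : Fin (m + 1) → Γ => U 0 = x), ‖kernel 𝕜 F (m + 1) U‖ ≤ nF (m + 1))
    (hG0 : ∀ (m : ℕ) (x : Γ), ∑ V ∈ univ.filter (fun V : Fin (m + 1) → Γ => V 0 = x), ‖kernel 𝕜 G (m + 1) V‖ ≤ nG (m + 1))
    (hFt : ∀ (m : ℕ) (i : Fin m), ∑ U ∈ univ.filter (fun U : Fin (m + 1) → Γ => U i.succ = w), ζ (U 0) * ‖kernel 𝕜 F (m + 1) U‖ ≤ tF (m + 1))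
    (hGt : ∀ (m : ℕ) (j : Fin m), ∑ V ∈ univ.filter (fun V : Fin (m + 1) → Γ => V j.succ = w), ζ (V 0) * ‖kernel 𝕜 G (m + 1) V‖ ≤ tG (m + 1))
    (n : ℕ) (p : Fin (n + 1)) :
    ∑ W ∈ univ.filter (fun W : Fin (n + 1) → Γ => W p = w),
        ‖kernel 𝕜 (∑ X, ∑ Y, C X Y • (grassmannDeriv 𝕜 X F * grassmannDeriv 𝕜 Y G)) (n + 1) W‖ ≤
      ∑ a ∈ range (n + 2), ∑ b ∈ range (n + 2),
        (if a + b = n + 1 then (((a + 1) * (b + 1) : ℕ) : ℝ) * (cR * tF (a + 1) * nG (b + 1) + cC * nF (a + 1) * tG (b + 1)) else 0) := by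
  classical
  -- the block functions
  set T : (a b : ℕ) → (Fin (a + b) → Γ) → 𝕜 := fun a b W => ∑ X, ∑ Y, C X Y *
    ((((a + 1 : ℕ) : 𝕜) * kernel 𝕜 F (a + 1) (Fin.cons X fun i => W (Fin.castAdd b i))) *
      (((b + 1 : ℕ) : 𝕜) * kernel 𝕜 G (b + 1) (Fin.cons Y fun j => W (Fin.natAdd a j)))) with hT
  set blk : ℕ → ℕ → ℝ := fun a b => (((a + 1) * (b + 1) : ℕ) : ℝ) * (cR * tF (a + 1) * nG (b + 1) + cC * nF (a + 1) * tG (b + 1)) with hblk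
  have hblk0 : ∀ a b, 0 ≤ blk a b := fun a b =>
    mul_nonneg (Nat.cast_nonneg _) (add_nonneg (mul_nonneg (mul_nonneg hcR (htF _)) (hnG _)) (mul_nonneg (mul_nonneg hcC (hnF _)) (htG _)))
  -- each block, read in degree `n + 1`
  have hblock : ∀ a b, ∑ W ∈ univ.filter (fun W : Fin (n + 1) → Γ => W p = w), ‖kernel 𝕜 (presented 𝕜 (T a b)) (n + 1) W‖ ≤
      if a + b = n + 1 then blk a b else 0 := by
    intro a b
    by_cases hab : a + b = n + 1
    · rw [if_pos hab, PolchinskiBilinearBound.presented_congr_deg hab (T a b)]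
      refine sum_norm_kernel_presented_le _ w (fun j => ?_) p
      rw [pinnedSum_congr_deg' hab (T a b) j w]
      exact pinnedSum_tensorBlock_le_weighted C ζ hcR hcC hR hC F G w (htF _) (htG _) (hF0 a) (hG0 b) (hFt a) (hGt b) _
    · rw [if_neg hab]
      refine le_of_eq (sum_eq_zero fun W _ => ?_)
      rw [kernel_presented_of_ne 𝕜 (T a b) W (Ne.symm hab), norm_zero]
  -- expand the bilinear term into blocks
  rw [PolchinskiBilinearBound.bilinear_eq_sum_presented C F G]
  calc ∑ W ∈ univ.filter (fun W : Fin (n + 1) → Γ => W p = w),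
        ‖kernel 𝕜 (∑ a ∈ range (Fintype.card Γ + 1), ∑ b ∈ range (Fintype.card Γ + 1), presented 𝕜 (T a b)) (n + 1) W‖
      ≤ ∑ W ∈ univ.filter (fun W : Fin (n + 1) → Γ => W p = w),
          ∑ a ∈ range (Fintype.card Γ + 1), ∑ b ∈ range (Fintype.card Γ + 1), ‖kernel 𝕜 (presented 𝕜 (T a b)) (n + 1) W‖ := by
        refine sum_le_sum fun W _ => ?_
        rw [kernel_sum]
        refine (norm_sum_le _ _).trans (sum_le_sum fun a _ => ?_)
        rw [kernel_sum]
        exact norm_sum_le _ _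
    _ = ∑ a ∈ range (Fintype.card Γ + 1), ∑ b ∈ range (Fintype.card Γ + 1),
          ∑ W ∈ univ.filter (fun W : Fin (n + 1) → Γ => W p = w), ‖kernel 𝕜 (presented 𝕜 (T a b)) (n + 1) W‖ := by
        rw [sum_comm]; exact sum_congr rfl fun a _ => sum_comm
    _ ≤ ∑ a ∈ range (Fintype.card Γ + 1), ∑ b ∈ range (Fintype.card Γ + 1), (if a + b = n + 1 then blk a b else 0) :=
        sum_le_sum fun a _ => sum_le_sum fun b _ => hblock a b
    _ ≤ ∑ a ∈ range (n + 2), ∑ b ∈ range (n + 2), (if a + b = n + 1 then blk a b else 0) :=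
        PolchinskiBilinearBound.sum_ite_le_sum_ite _ n blk hblk0

/-! ## §4 Far-supported line: first moments over the distance -/

/-- **THE BILINEAR TERM WITH A FAR-SUPPORTED LINE.**  If `C X Y = 0` unless both `X, Y ∈ Zs`, the plain row/column sums of `‖C‖` are `≤ cR, cC`,
and every `X ∈ Zs` has `R ≤ d X` for a nonnegative "distance from the pin value `w`" `d` and `R > 0`, then at the pin value `w`
`Σ_{W : W_p = w} ‖kernel (Σ_{X,Y} C X Y • ∂_X F ∂_Y G) (n+1) W‖ ≤ Σ_{a+b=n+1} (a+1)(b+1)·(cR·(mF(a+1)/R)·nG(b+1) + cC·nF(a+1)·(mG(b+1)/R))`,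
where `mF(m)` bounds the `d(leg 0)`-FIRST MOMENTS of `kernel F m` pinned at value `w` on another leg (the weight `ζ = d/R` dominates `1_{Zs}`).
The far half of the defect step of the nested two-volume pass: a line supported at distance `≥ R` from the pin costs a first moment over `R`.
[folklore; Salmhofer 1998 §4.1 Lemma 1 with a weight] -/
theorem sum_norm_kernel_bilinear_le_of_far (C : Matrix Γ Γ 𝕜) {Zs : Set Γ} [DecidablePred (· ∈ Zs)]
    (hfar : ∀ X Y, ¬ (X ∈ Zs ∧ Y ∈ Zs) → C X Y = 0)
    {cR cC : ℝ} (hcR : 0 ≤ cR) (hcC : 0 ≤ cC) (hR : ∀ X, ∑ Y, ‖C X Y‖ ≤ cR) (hC : ∀ Y, ∑ X, ‖C X Y‖ ≤ cC)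
    (d : Γ → ℝ) (hd0 : ∀ X, 0 ≤ d X) {R : ℝ} (hRpos : 0 < R) (hdR : ∀ X, X ∈ Zs → R ≤ d X)
    (F G : GrassmannAlgebra 𝕜 Γ) (w : Γ) (nF nG mF mG : ℕ → ℝ) (hmF : ∀ m, 0 ≤ mF m) (hmG : ∀ m, 0 ≤ mG m)
    (hnF : ∀ m, 0 ≤ nF m) (hnG : ∀ m, 0 ≤ nG m)
    (hF0 : ∀ (m : ℕ) (x : Γ), ∑ U ∈ univ.filter (fun U : Fin (m + 1) → Γ => U 0 = x), ‖kernel 𝕜 F (m + 1) U‖ ≤ nF (m + 1))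
    (hG0 : ∀ (m : ℕ) (x : Γ), ∑ V ∈ univ.filter (fun V : Fin (m + 1) → Γ => V 0 = x), ‖kernel 𝕜 G (m + 1) V‖ ≤ nG (m + 1))
    (hFm : ∀ (m : ℕ) (i : Fin m), ∑ U ∈ univ.filter (fun U : Fin (m + 1) → Γ => U i.succ = w), d (U 0) * ‖kernel 𝕜 F (m + 1) U‖ ≤ mF (m + 1))
    (hGm : ∀ (m : ℕ) (j : Fin m), ∑ V ∈ univ.filter (fun V : Fin (m + 1) → Γ => V j.succ = w), d (V 0) * ‖kernel 𝕜 G (m + 1) V‖ ≤ mG (m + 1))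
    (n : ℕ) (p : Fin (n + 1)) :
    ∑ W ∈ univ.filter (fun W : Fin (n + 1) → Γ => W p = w),
        ‖kernel 𝕜 (∑ X, ∑ Y, C X Y • (grassmannDeriv 𝕜 X F * grassmannDeriv 𝕜 Y G)) (n + 1) W‖ ≤
      ∑ a ∈ range (n + 2), ∑ b ∈ range (n + 2),
        (if a + b = n + 1 then (((a + 1) * (b + 1) : ℕ) : ℝ) *
          (cR * (mF (a + 1) / R) * nG (b + 1) + cC * nF (a + 1) * (mG (b + 1) / R)) else 0) := by
  -- the weight `ζ = d/R` dominates the indicator of `Zs` on the rows/columns of `C`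
  have hζrow : ∀ X, ∑ Y, ‖C X Y‖ ≤ cR * (d X / R) := by
    intro X
    by_cases hX : X ∈ Zs
    · calc ∑ Y, ‖C X Y‖ ≤ cR := hR X
        _ = cR * (R / R) := by rw [div_self hRpos.ne', mul_one]
        _ ≤ cR * (d X / R) := mul_le_mul_of_nonneg_left (div_le_div_of_nonneg_right (hdR X hX) hRpos.le) hcR
    · have h0 : ∀ Y, C X Y = 0 := fun Y => hfar X Y (fun h => hX h.1)
      simp only [h0, norm_zero, sum_const_zero]
      exact mul_nonneg hcR (div_nonneg (hd0 X) hRpos.le)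
  have hζcol : ∀ Y, ∑ X, ‖C X Y‖ ≤ cC * (d Y / R) := by
    intro Y
    by_cases hY : Y ∈ Zs
    · calc ∑ X, ‖C X Y‖ ≤ cC := hC Y
        _ = cC * (R / R) := by rw [div_self hRpos.ne', mul_one]
        _ ≤ cC * (d Y / R) := mul_le_mul_of_nonneg_left (div_le_div_of_nonneg_right (hdR Y hY) hRpos.le) hcC
    · have h0 : ∀ X, C X Y = 0 := fun X => hfar X Y (fun h => hY h.2)
      simp only [h0, norm_zero, sum_const_zero]
      exact mul_nonneg hcC (div_nonneg (hd0 Y) hRpos.le)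
  -- the weighted moments are the first moments over `R`
  have hFt : ∀ (m : ℕ) (i : Fin m), ∑ U ∈ univ.filter (fun U : Fin (m + 1) → Γ => U i.succ = w),
      (d (U 0) / R) * ‖kernel 𝕜 F (m + 1) U‖ ≤ mF (m + 1) / R := fun m i => by
    have h : ∀ U : Fin (m + 1) → Γ, (d (U 0) / R) * ‖kernel 𝕜 F (m + 1) U‖ = (d (U 0) * ‖kernel 𝕜 F (m + 1) U‖) / R := fun U => by ring
    simp_rw [h]; rw [← sum_div]; exact div_le_div_of_nonneg_right (hFm m i) hRpos.le
  have hGt : ∀ (m : ℕ) (j : Fin m), ∑ V ∈ univ.filter (fun V : Fin (m + 1) → Γ => V j.succ = w),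
      (d (V 0) / R) * ‖kernel 𝕜 G (m + 1) V‖ ≤ mG (m + 1) / R := fun m j => by
    have h : ∀ V : Fin (m + 1) → Γ, (d (V 0) / R) * ‖kernel 𝕜 G (m + 1) V‖ = (d (V 0) * ‖kernel 𝕜 G (m + 1) V‖) / R := fun V => by ring
    simp_rw [h]; rw [← sum_div]; exact div_le_div_of_nonneg_right (hGm m j) hRpos.le
  exact sum_norm_kernel_bilinear_le_weighted C (fun X => d X / R) hcR hcC hζrow hζcol F G w nF nG
    (fun m => mF m / R) (fun m => mG m / R) (fun m => div_nonneg (hmF m) hRpos.le) (fun m => div_nonneg (hmG m) hRpos.le)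
    hnF hnG hF0 hG0 hFt hGt n p

end Assembly

end Summit.HubbardSuperconductivity.HubbardSuperconductivity.Theorems.TwoVolumeDefect

end
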